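import Literature.Analysis.FluidPDE.CarlemanSecondWeight
import Literature.Analysis.FluidPDE.CarlemanConjugate
import HarnessLib

/-!
# The second (anisotropic) Carleman inequality of Escauriaza–Seregin–Šverák, proved (Seregin 2014, Prop. 1.3)

Analysis/FluidPDE file in the backward-uniqueness track of the decomposition of **ns.S08**
`Literature.Analysis.FluidPDE.ess_endpoint` (ESS 2003, Thm. 1.3 ⇐ Thm. 1.4 ⇐ Thm. 5.1
(backward uniqueness in a half-space) ⇐ the two Carleman inequalities of §6 = Seregin 2014,
App. A.1, Props. 1.2–1.3). The first inequality is `FluidPDE/CarlemanFirstWeight`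
(`carleman_inequality_first`). Here we prove the second one, (A.1.12):

for `1/2 < α < 1`, `a ≥ 2`, a unit vector `eₙ` of a finite-dimensional real inner product space
`E`, the weight `φ = -|x'|²/(8t) + a(1-t)xₙ^{2α}/t^α` (`xₙ = ⟪x,eₙ⟫`, `|x'|² = |x|² - xₙ²`), and
every `u ∈ C_c^∞` supported in `{xₙ > 1} × ]0, 1[`,

`∫ t² e^{2φ} (a|u|²/t² + |∇u|²/t) ≤ c⋆(α) ∫ t² e^{2φ} |∂ₜu + Δu|²`, `c⋆(α) = 5 + 3/(2α-1)`

(`carleman_inequality_second`; the source has unspecified `c⋆(α)` and `a > a₀(α)`).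
The proof is Seregin's `L₂`-method, on top of the general machinery
(`CarlemanCommutator`: `S`, `A`, (A.1.6); `CarlemanConjugate`: (A.1.2), (A.1.5), (A.1.11),
(A.1.24); `CarlemanSecondWeight`: the derivative fields of the weight, (A.1.13)–(A.1.18)):

* `weightW`, `two_mul_integral_inner_opSW_opAW_phiKR` — the **exact** value of
  `I = 2∫⟪Sv, Av⟫ = ∫ t|∂ₙv|² + 4∫ t² a k ρ''|∂ₙv|² + ∫ W|v|²` for the weight
  `-|x'|²/(8t) + a k(t)ρ(xₙ)` (all `|x'|²`-terms cancel: `I₁ = -∫t(|∇v|² - |∂ₙv|²)`, (A.1.18));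
* `kA`, `rhoA` — the profiles `k = (1-t)t^{-α}`, `ρ = s^{2α}` and their derivatives;
* `weightW_core`, `weightW_lower_bound` — (A.1.19)–(A.1.23):
  `W ≥ t(a k ρ')² + a(2α-1)xₙ^{2α}t^{-α}` for `0 < t ≤ 1 ≤ xₙ`, `a ≥ 2`
  (`A₂ ≥ 0`, `A₁ ≥ |∇φ⁽²⁾|²/t`, `A₃ ≥ a(2α-1)xₙ^{2α}t^{-α-2}`);
* `carleman_inequality_second` — (A.1.24)–(A.1.26) and the assembly.

All statements are proved.

## References

* G. Seregin, *Lecture notes on regularity theory for the Navier–Stokes equations*, World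
  Scientific 2014, Appendix A.1, Prop. 1.3, (A.1.12)–(A.1.26).
* L. Escauriaza, G. Seregin, V. Šverák, *`L_{3,∞}`-solutions of Navier–Stokes equations and
  backward uniqueness*, Russ. Math. Surveys 58:2 (2003), §6 (second Carleman inequality).
* L. Escauriaza, G. Seregin, V. Šverák, *Backward uniqueness for parabolic equations*,
  Arch. Ration. Mech. Anal. 169 (2003).
-/

noncomputable section

open MeasureTheory Set Function Filter Topology
open scoped InnerProductSpace RealInnerProductSpace

namespace Literature.Analysis.FluidPDE

namespace Carleman

section SecondIdentity

variable {E : Type*} [NormedAddCommGroup E] [InnerProductSpace ℝ E] [FiniteDimensional ℝ E]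
  [MeasurableSpace E] [BorelSpace E]
variable {F : Type*} [NormedAddCommGroup F] [InnerProductSpace ℝ F]

/-- The zeroth-order weight of the commutator identity for the anisotropic weight (the terms
of (A.1.6) in `|v|²` that survive the cancellation of all `|x'|²`-contributions of `φ⁽¹⁾`):
with `g = a k ρ'`, `c = a k ρ''`,
`W = 4t² c g² + t² (a k'' ρ) - 4t² g (a k' ρ') - t² a k ρ⁗ - t g² + t a k' ρ`
— in Seregin's notation `W = 4t² φ⁽²⁾ᵢⱼφ⁽²⁾ᵢφ⁽²⁾ⱼ + t²(A₁ + A₂ + A₃)` ((A.1.19)). [cite: Seregin2014, App. A.1 (A.1.17)–(A.1.19)] -/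
def weightW (a : ℝ) (k ρ : ℝ → ℝ) (en : E) (z : ℝ × E) : ℝ :=
  4 * z.1 ^ 2 * (a * k z.1 * deriv^[2] ρ ⟪z.2, en⟫) * (a * k z.1 * deriv ρ ⟪z.2, en⟫) ^ 2 +
    z.1 ^ 2 * (a * deriv^[2] k z.1 * ρ ⟪z.2, en⟫) -
    4 * z.1 ^ 2 * (a * k z.1 * deriv ρ ⟪z.2, en⟫) * (a * deriv k z.1 * deriv ρ ⟪z.2, en⟫) -
    z.1 ^ 2 * (a * k z.1 * deriv^[4] ρ ⟪z.2, en⟫) -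
    z.1 * (a * k z.1 * deriv ρ ⟪z.2, en⟫) ^ 2 + z.1 * (a * deriv k z.1 * ρ ⟪z.2, en⟫)

variable {k ρ : ℝ → ℝ} (hk : ContDiffOn ℝ (⊤ : ℕ∞) k (Ioi 0)) (hρ : ContDiffOn ℝ (⊤ : ℕ∞) ρ (Ioi 0))
variable {a δ : ℝ} {en : E} (hen : ‖en‖ = 1) {V : ℝ × E → F}
variable (hδ : 0 < δ) (hV : ContDiff ℝ (⊤ : ℕ∞) V) (hVc : HasCompactSupport V)
  (hVΩ : tsupport V ⊆ halfDom en) (hVδ : tsupport V ⊆ {z | δ ≤ z.1})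
include hk hρ hen hδ hV hVc hVΩ hVδ

omit [FiniteDimensional ℝ E] [MeasurableSpace E] [BorelSpace E] hen hδ hV hVc hVΩ hVδ in
/-- `W` is continuous on `Ω`. [folklore] -/
theorem continuousOn_weightW : ContinuousOn (weightW a k ρ en) (halfDom en) := by
  have ck : ∀ j, ContinuousOn (fun z : ℝ × E => deriv^[j] k z.1) (halfDom en) := fun j =>
    (contDiffOn_iterate_deriv_Ioi hk j).continuousOn.comp continuous_fst.continuousOn fun z hz => hz.1
  have cρ : ∀ j, ContinuousOn (fun z : ℝ × E => deriv^[j] ρ ⟪z.2, en⟫) (halfDom en) := fun j =>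
    (contDiffOn_iterate_deriv_Ioi hρ j).continuousOn.comp
      (continuous_snd.inner continuous_const).continuousOn fun z hz => hz.2
  have ct : ContinuousOn (fun z : ℝ × E => z.1) (halfDom en) := continuous_fst.continuousOn
  have ct2 : ContinuousOn (fun z : ℝ × E => z.1 ^ 2) (halfDom en) := (continuous_fst.pow 2).continuousOn
  have ck0 : ContinuousOn (fun z : ℝ × E => k z.1) (halfDom en) := ck 0
  have ck1 : ContinuousOn (fun z : ℝ × E => deriv k z.1) (halfDom en) := ck 1
  have ck2 : ContinuousOn (fun z : ℝ × E => deriv^[2] k z.1) (halfDom en) := ck 2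
  have cρ0 : ContinuousOn (fun z : ℝ × E => ρ ⟪z.2, en⟫) (halfDom en) := cρ 0
  have cρ1 : ContinuousOn (fun z : ℝ × E => deriv ρ ⟪z.2, en⟫) (halfDom en) := cρ 1
  have cρ2 : ContinuousOn (fun z : ℝ × E => deriv^[2] ρ ⟪z.2, en⟫) (halfDom en) := cρ 2
  have cρ4 : ContinuousOn (fun z : ℝ × E => deriv^[4] ρ ⟪z.2, en⟫) (halfDom en) := cρ 4
  have cc : ContinuousOn (fun z : ℝ × E => a * k z.1 * deriv^[2] ρ ⟪z.2, en⟫) (halfDom en) :=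
    (continuousOn_const.mul ck0).mul cρ2
  have cg : ContinuousOn (fun z : ℝ × E => a * k z.1 * deriv ρ ⟪z.2, en⟫) (halfDom en) :=
    (continuousOn_const.mul ck0).mul cρ1
  unfold weightW
  exact ((((((((continuousOn_const.mul ct2).mul cc).mul (cg.pow 2)).add
    (ct2.mul ((continuousOn_const.mul ck2).mul cρ0))).sub
    (((continuousOn_const.mul ct2).mul cg).mul ((continuousOn_const.mul ck1).mul cρ1))).sub
    (ct2.mul ((continuousOn_const.mul ck0).mul cρ4))).sub (ct.mul (cg.pow 2))).add
    (ct.mul ((continuousOn_const.mul ck1).mul cρ0)))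

/-- **The commutator identity for the anisotropic weight** (Seregin 2014, (A.1.17)–(A.1.18) and
the algebra behind (A.1.19)): for `v` smooth, compactly supported in `Ω ∩ {t ≥ δ}`,
`2∫⟪Sv, Av⟫ = ∫ t |∂ₙv|² + 4 ∫ t² a k ρ'' |∂ₙv|² + ∫ W |v|²`
— all `|x'|²`-terms of `φ⁽¹⁾` cancel (`I₁ = -∫ t(|∇v|² - |∂ₙv|²)`), exactly. [cite: Seregin2014, App. A.1 (A.1.18)] -/
theorem two_mul_integral_inner_opSW_opAW_phiKR :
    2 * ∫ z, ⟪opSW (phiKR a k ρ en) V z, opAW (phiKR a k ρ en) V z⟫ =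
      (∫ z, z.1 * ‖fderiv ℝ V z (0, en)‖ ^ 2) +
      4 * (∫ z, z.1 ^ 2 * (a * k z.1 * deriv^[2] ρ ⟪z.2, en⟫) * ‖fderiv ℝ V z (0, en)‖ ^ 2) +
      ∫ z, weightW a k ρ en z * ‖V z‖ ^ 2 := by
  have hΩ := isOpen_halfDom en
  have hφ := contDiffOn_phiKR hk hρ a en
  rw [two_mul_integral_inner_opSW_opAW_printed hΩ hφ hδ hV hVc hVΩ hVδ]
  set b := stdOrthonormalBasis ℝ E with hb
  have hV0 : ∀ z ∉ halfDom en, fderiv ℝ V z = 0 := fun z hz =>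
    fderiv_of_notMem_tsupport (𝕜 := ℝ) fun h => hz (hVΩ h)
  have hV00 : ∀ z ∉ halfDom en, V z = 0 := fun z hz =>
    image_eq_zero_of_notMem_tsupport fun h => hz (hVΩ h)
  -- continuity on `Ω` of the coefficient functions
  have ck : ∀ j, ContinuousOn (fun z : ℝ × E => deriv^[j] k z.1) (halfDom en) := fun j =>
    (contDiffOn_iterate_deriv_Ioi hk j).continuousOn.comp continuous_fst.continuousOn fun z hz => hz.1
  have cρ : ∀ j, ContinuousOn (fun z : ℝ × E => deriv^[j] ρ ⟪z.2, en⟫) (halfDom en) := fun j =>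
    (contDiffOn_iterate_deriv_Ioi hρ j).continuousOn.comp
      (continuous_snd.inner continuous_const).continuousOn fun z hz => hz.2
  have ct : ContinuousOn (fun z : ℝ × E => z.1) (halfDom en) := continuous_fst.continuousOn
  have cc : ContinuousOn (fun z : ℝ × E => a * k z.1 * deriv^[2] ρ ⟪z.2, en⟫) (halfDom en) :=
    (continuousOn_const.mul (ck 0)).mul (cρ 2)
  -- ## the Hessian term
  set Wn : ℝ × E → F := fun z => fderiv ℝ V z (0, en) with hWn
  have cWn : Continuous Wn := (hV.continuous_fderiv (by simp)).clm_apply continuous_const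
  have hWns : tsupport Wn ⊆ tsupport V := by
    refine closure_minimal (fun z hz => ?_) (isClosed_tsupport V)
    by_contra h
    exact hz (by simp [hWn, fderiv_of_notMem_tsupport (𝕜 := ℝ) h])
  have hWnc : HasCompactSupport Wn := hVc.mono' ((subset_tsupport _).trans hWns)
  have iH : ∀ i j, Integrable fun z : ℝ × E => z.1 ^ 2 * dx (b i) (dx (b j) (phiKR a k ρ en)) z *
      ⟪dx (b j) V z, dx (b i) V z⟫ := fun i j =>
    integrable_mul_inner_of_open hΩ hVΩ
      ((continuous_fst.pow 2).continuousOn.mul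
        (contDiffOn_fderiv_apply_const_of_open hΩ (contDiffOn_dx hΩ hφ _) _).continuousOn)
      (contDiff_dx hV _).continuous.continuousOn (contDiff_dx hV _).continuous.continuousOn
      (hasCompactSupport_dx hVc _) (tsupport_dx_subset _ V)
  have iG : Integrable fun z : ℝ × E => z.1 * gradSq V z := integrable_mul_gradSq hV hVc continuous_id
  have iN : Integrable fun z : ℝ × E => z.1 * ‖Wn z‖ ^ 2 :=
    integrable_of_continuous_hasCompactSupport (continuous_fst.mul (cWn.norm.pow 2))
      (hasCompactSupport_mul_norm_sq hWnc)
  have iC : Integrable fun z : ℝ × E => z.1 ^ 2 * (a * k z.1 * deriv^[2] ρ ⟪z.2, en⟫) * ‖Wn z‖ ^ 2 :=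
    integrable_of_continuous_hasCompactSupport
      (continuous_mul_norm_sq_of_tsupport_subset hΩ ((continuous_fst.pow 2).continuousOn.mul cc) cWn
        (hWns.trans hVΩ))
      (hasCompactSupport_mul_norm_sq hWnc)
  have hH : 4 * (∑ i, ∑ j, ∫ z, z.1 ^ 2 * dx (b i) (dx (b j) (phiKR a k ρ en)) z *
      ⟪dx (b j) V z, dx (b i) V z⟫) =
      -(∫ z : ℝ × E, z.1 * gradSq V z) + (∫ z : ℝ × E, z.1 * ‖Wn z‖ ^ 2) +
        4 * ∫ z : ℝ × E, z.1 ^ 2 * (a * k z.1 * deriv^[2] ρ ⟪z.2, en⟫) * ‖Wn z‖ ^ 2 := by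
    have e1 : ∑ i, ∑ j, ∫ z, z.1 ^ 2 * dx (b i) (dx (b j) (phiKR a k ρ en)) z *
        ⟪dx (b j) V z, dx (b i) V z⟫ =
        ∫ z, ∑ i, ∑ j, z.1 ^ 2 * dx (b i) (dx (b j) (phiKR a k ρ en)) z * ⟪dx (b j) V z, dx (b i) V z⟫ := by
      rw [integral_finsetSum _ fun i _ => integrable_finsetSum _ fun j _ => iH i j]
      refine Finset.sum_congr rfl fun i _ => ?_
      rw [integral_finsetSum _ fun j _ => iH i j]
    have e2 : ∀ z, ∑ i, ∑ j, z.1 ^ 2 * dx (b i) (dx (b j) (phiKR a k ρ en)) z * ⟪dx (b j) V z, dx (b i) V z⟫ =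
        -(1 / 4) * (z.1 * gradSq V z) + (1 / 4) * (z.1 * ‖Wn z‖ ^ 2) +
          z.1 ^ 2 * (a * k z.1 * deriv^[2] ρ ⟪z.2, en⟫) * ‖Wn z‖ ^ 2 := by
      intro z
      by_cases hz : z ∈ halfDom en
      · have h := sum_hess_phiKR_inner hk hρ a en hz V
        simp only [← hb] at h
        have e : ∑ i, ∑ j, z.1 ^ 2 * dx (b i) (dx (b j) (phiKR a k ρ en)) z * ⟪dx (b j) V z, dx (b i) V z⟫ =
            z.1 ^ 2 * ∑ i, ∑ j, dx (b i) (dx (b j) (phiKR a k ρ en)) z * ⟪dx (b j) V z, dx (b i) V z⟫ := by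
          rw [Finset.mul_sum]
          refine Finset.sum_congr rfl fun i _ => ?_
          rw [Finset.mul_sum]
          refine Finset.sum_congr rfl fun j _ => ?_
          ring
        rw [e, h, hWn]
        have ht : z.1 ≠ 0 := hz.1.ne'
        field_simp
        ring
      · have hW0 : Wn z = 0 := by simp only [hWn, hV0 z hz]; rfl
        simp [hW0, hV0 z hz, gradSq]
    have i1 : Integrable (fun z : ℝ × E => -(1 / 4) * (z.1 * gradSq V z)) := iG.const_mul _
    have i2 : Integrable (fun z : ℝ × E => (1 / 4) * (z.1 * ‖Wn z‖ ^ 2)) := iN.const_mul _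
    have i12 : Integrable (fun z : ℝ × E => -(1 / 4) * (z.1 * gradSq V z) + (1 / 4) * (z.1 * ‖Wn z‖ ^ 2)) :=
      i1.add i2
    rw [e1, integral_congr_ae (Eventually.of_forall e2), integral_add i12 iC, integral_add i1 i2,
      integral_const_mul, integral_const_mul]
    ring
  -- ## the zeroth-order terms
  have cS : ContinuousOn (fun z => ∑ i, ∑ j, dx (b i) (dx (b j) (phiKR a k ρ en)) z *
      dx (b i) (phiKR a k ρ en) z * dx (b j) (phiKR a k ρ en) z) (halfDom en) :=
    continuousOn_finsetSum _ fun i _ => continuousOn_finsetSum _ fun j _ =>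
      (((contDiffOn_fderiv_apply_const_of_open hΩ (contDiffOn_dx hΩ hφ _) _).continuousOn.mul
        (contDiffOn_dx hΩ hφ _).continuousOn).mul (contDiffOn_dx hΩ hφ _).continuousOn)
  have ct2 : ContinuousOn (fun z : ℝ × E => z.1 ^ 2) (halfDom en) := (continuous_fst.pow 2).continuousOn
  have cdtdt : ContinuousOn (dt (dt (phiKR a k ρ en))) (halfDom en) :=
    (contDiffOn_fderiv_apply_const_of_open hΩ (contDiffOn_dt hΩ hφ) _).continuousOn
  have cdtg : ContinuousOn (dt (fun y => ‖gradX (phiKR a k ρ en) y‖ ^ 2)) (halfDom en) :=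
    (contDiffOn_fderiv_apply_const_of_open hΩ ((contDiffOn_gradX hΩ hφ).norm_sq ℝ) _).continuousOn
  have clap2 : ContinuousOn (lap (lap (phiKR a k ρ en))) (halfDom en) :=
    (contDiffOn_lap_of_open hΩ (contDiffOn_lap_of_open hΩ hφ)).continuousOn
  have cq : ContinuousOn (qW (phiKR a k ρ en)) (halfDom en) := (contDiffOn_qW hΩ hφ).continuousOn
  have cW : ContinuousOn (weightW a k ρ en) (halfDom en) := continuousOn_weightW hk hρ
  have jS := integrable_mul_norm_sq_of_open hΩ hV hVc hVΩ (ct2.mul cS)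
  have jP := integrable_mul_norm_sq_of_open hΩ hV hVc hVΩ
    (w := fun z => z.1 ^ 2 * (dt (dt (phiKR a k ρ en)) z -
      2 * dt (fun y => ‖gradX (phiKR a k ρ en) y‖ ^ 2) z - lap (lap (phiKR a k ρ en)) z))
    (ct2.mul ((cdtdt.sub (continuousOn_const.mul cdtg)).sub clap2))
  have jq := integrable_mul_norm_sq_of_open hΩ hV hVc hVΩ (w := fun z => z.1 * qW (phiKR a k ρ en) z)
    (ct.mul cq)
  have jW := integrable_mul_norm_sq_of_open hΩ hV hVc hVΩ cW
  have hZ : 4 * (∫ z, z.1 ^ 2 * (∑ i, ∑ j, dx (b i) (dx (b j) (phiKR a k ρ en)) z *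
        dx (b i) (phiKR a k ρ en) z * dx (b j) (phiKR a k ρ en) z) * ‖V z‖ ^ 2) +
      (∫ z, z.1 ^ 2 * (dt (dt (phiKR a k ρ en)) z - 2 * dt (fun y => ‖gradX (phiKR a k ρ en) y‖ ^ 2) z -
        lap (lap (phiKR a k ρ en)) z) * ‖V z‖ ^ 2) -
      (∫ z, z.1 * qW (phiKR a k ρ en) z * ‖V z‖ ^ 2) = ∫ z, weightW a k ρ en z * ‖V z‖ ^ 2 := by
    have kS : Integrable (fun z => 4 * (z.1 ^ 2 * (∑ i, ∑ j, dx (b i) (dx (b j) (phiKR a k ρ en)) z *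
        dx (b i) (phiKR a k ρ en) z * dx (b j) (phiKR a k ρ en) z) * ‖V z‖ ^ 2)) := jS.const_mul 4
    have kSP : Integrable (fun z => 4 * (z.1 ^ 2 * (∑ i, ∑ j, dx (b i) (dx (b j) (phiKR a k ρ en)) z *
        dx (b i) (phiKR a k ρ en) z * dx (b j) (phiKR a k ρ en) z) * ‖V z‖ ^ 2) +
        z.1 ^ 2 * (dt (dt (phiKR a k ρ en)) z - 2 * dt (fun y => ‖gradX (phiKR a k ρ en) y‖ ^ 2) z -
          lap (lap (phiKR a k ρ en)) z) * ‖V z‖ ^ 2) := kS.add jP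
    rw [← integral_const_mul, ← integral_add kS jP, ← integral_sub kSP jq]
    refine integral_congr_ae (Eventually.of_forall fun z => ?_)
    by_cases hz : z ∈ halfDom en
    · show 4 * (z.1 ^ 2 * (∑ i, ∑ j, dx (b i) (dx (b j) (phiKR a k ρ en)) z *
          dx (b i) (phiKR a k ρ en) z * dx (b j) (phiKR a k ρ en) z) * ‖V z‖ ^ 2) +
          z.1 ^ 2 * (dt (dt (phiKR a k ρ en)) z - 2 * dt (fun y => ‖gradX (phiKR a k ρ en) y‖ ^ 2) z -
            lap (lap (phiKR a k ρ en)) z) * ‖V z‖ ^ 2 -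
          z.1 * qW (phiKR a k ρ en) z * ‖V z‖ ^ 2 = weightW a k ρ en z * ‖V z‖ ^ 2
      have hg := sum_hess_phiKR_grad hk hρ a hen hz
      simp only [← hb] at hg
      rw [hg, dt_dt_phiKR hk hρ a en hz, dt_norm_gradX_phiKR_sq hk hρ a hen hz,
        lap_lap_phiKR hk hρ a hen hz, qW, norm_gradX_phiKR_sq hk hρ a hen hz, dt_phiKR hk hρ a en hz,
        weightW]
      have ht : z.1 ≠ 0 := hz.1.ne'
      field_simp
      ring
    · simp [hV00 z hz]
  rw [hH, ← hZ]
  ring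

end SecondIdentity


section SecondProfiles

/-! ### The profiles of Prop. 1.3: `k(t) = (1-t)t^{-α}`, `ρ(s) = s^{2α}` -/

/-- `k_α(t) = t^{-α} - t^{1-α} = (1 - t) t^{-α}` (time profile of `φ⁽²⁾ = a k(t) xₙ^{2α}`). [cite: Seregin2014, App. A.1 Prop. 1.3] -/
def kA (α : ℝ) (t : ℝ) : ℝ := t ^ (-α) - t ^ (1 - α)

/-- `ρ_α(s) = s^{2α}` (space profile of `φ⁽²⁾`). [cite: Seregin2014, App. A.1 Prop. 1.3] -/
def rhoA (α : ℝ) (s : ℝ) : ℝ := s ^ (2 * α)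

/-- `k_α(t) = (1 - t) t^{-α}` for `t > 0`. [cite: Seregin2014, App. A.1 Prop. 1.3] -/
theorem kA_eq (α : ℝ) {t : ℝ} (ht : 0 < t) : kA α t = (1 - t) * t ^ (-α) := by
  rw [kA, show (1 : ℝ) - α = 1 + -α by ring, Real.rpow_add ht, Real.rpow_one]
  ring

/-- Power functions are smooth on `]0, ∞[`. [folklore] -/
theorem contDiffOn_rpow_const_Ioi (p : ℝ) : ContDiffOn ℝ (⊤ : ℕ∞) (fun t : ℝ => t ^ p) (Ioi 0) :=
  fun _ ht => (Real.contDiffAt_rpow_const_of_ne (p := p) (ne_of_gt ht)).contDiffWithinAt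

/-- `k_α ∈ C^∞(]0, ∞[)`. [folklore] -/
theorem contDiffOn_kA (α : ℝ) : ContDiffOn ℝ (⊤ : ℕ∞) (kA α) (Ioi 0) :=
  (contDiffOn_rpow_const_Ioi _).sub (contDiffOn_rpow_const_Ioi _)

/-- `ρ_α ∈ C^∞(]0, ∞[)`. [folklore] -/
theorem contDiffOn_rhoA (α : ℝ) : ContDiffOn ℝ (⊤ : ℕ∞) (rhoA α) (Ioi 0) :=
  contDiffOn_rpow_const_Ioi _

/-- `(c s^p)' = c p s^{p-1}` everywhere (Mathlib's junk-value conventions make this global). [folklore] -/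
theorem deriv_const_mul_rpow (c p : ℝ) :
    deriv (fun s : ℝ => c * s ^ p) = fun s => c * p * s ^ (p - 1) := by
  funext s
  rw [deriv_const_mul_field, Real.deriv_rpow_const]
  ring

/-- `ρ' = 2α s^{2α-1}`. [folklore] -/
theorem deriv_rhoA (α : ℝ) : deriv (rhoA α) = fun s => 2 * α * s ^ (2 * α - 1) := by
  have h := deriv_const_mul_rpow 1 (2 * α)
  simp only [one_mul] at h
  exact h

/-- `ρ'' = 2α(2α-1) s^{2α-2}`. [folklore] -/
theorem deriv2_rhoA (α : ℝ) :
    deriv^[2] (rhoA α) = fun s => 2 * α * (2 * α - 1) * s ^ (2 * α - 2) := by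
  rw [Function.iterate_succ_apply, Function.iterate_one, deriv_rhoA, deriv_const_mul_rpow]
  funext s
  rw [show 2 * α - 1 - 1 = 2 * α - 2 by ring]

/-- `ρ⁗ = 2α(2α-1)(2α-2)(2α-3) s^{2α-4}`. [folklore] -/
theorem deriv4_rhoA (α : ℝ) :
    deriv^[4] (rhoA α) =
      fun s => 2 * α * (2 * α - 1) * (2 * α - 2) * (2 * α - 3) * s ^ (2 * α - 4) := by
  rw [show (4 : ℕ) = 2 + 2 from rfl, Function.iterate_add_apply, deriv2_rhoA,
    Function.iterate_succ_apply, Function.iterate_one, deriv_const_mul_rpow, deriv_const_mul_rpow]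
  funext s
  rw [show 2 * α - 2 - 1 - 1 = 2 * α - 4 by ring, show 2 * α - 2 - 1 = 2 * α - 3 by ring]

/-- `k' = -α t^{-α-1} - (1-α) t^{-α}` on `t > 0`. [folklore] -/
theorem deriv_kA (α : ℝ) {t : ℝ} (ht : 0 < t) :
    deriv (kA α) t = -α * t ^ (-α - 1) - (1 - α) * t ^ (-α) := by
  have h1 := Real.hasDerivAt_rpow_const (p := -α) (Or.inl ht.ne')
  have h2 := Real.hasDerivAt_rpow_const (p := 1 - α) (Or.inl ht.ne')
  have h : HasDerivAt (kA α) (-α * t ^ (-α - 1) - (1 - α) * t ^ (1 - α - 1)) t := by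
    have := h1.sub h2
    exact this.congr_deriv (by ring)
  rw [h.deriv, show 1 - α - 1 = -α by ring]

/-- `k'' = α(α+1) t^{-α-2} + α(1-α) t^{-α-1}` on `t > 0`. [folklore] -/
theorem deriv2_kA (α : ℝ) {t : ℝ} (ht : 0 < t) :
    deriv^[2] (kA α) t = α * (α + 1) * t ^ (-α - 2) + α * (1 - α) * t ^ (-α - 1) := by
  have hev : deriv (kA α) =ᶠ[𝓝 t] fun t => -α * t ^ (-α - 1) - (1 - α) * t ^ (-α) := by
    filter_upwards [isOpen_Ioi.mem_nhds ht] with u hu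
    exact deriv_kA α hu
  rw [Function.iterate_succ_apply, Function.iterate_one, hev.deriv_eq]
  have h1 := (Real.hasDerivAt_rpow_const (p := -α - 1) (Or.inl ht.ne')).const_mul (-α)
  have h2 := (Real.hasDerivAt_rpow_const (p := -α) (Or.inl ht.ne')).const_mul (1 - α)
  have h : HasDerivAt (fun t : ℝ => -α * t ^ (-α - 1) - (1 - α) * t ^ (-α))
      (α * (α + 1) * t ^ (-α - 2) + α * (1 - α) * t ^ (-α - 1)) t := by
    have := h1.sub h2
    refine this.congr_deriv ?_
    rw [show -α - 1 - 1 = -α - 2 by ring]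
    ring
  exact h.deriv

/-! #### Values on `Ω` in the form `A₀ = t^{-α}`, `B₀ = s^{2α}` -/

/-- `t^{-α-j} = t^{-α}/t^j`. [folklore] -/
theorem rpow_neg_sub_nat {t : ℝ} (ht : 0 < t) (α : ℝ) (j : ℕ) :
    t ^ (-α - j) = t ^ (-α) / t ^ j := by
  rw [show -α - (j : ℝ) = -α - (j : ℝ) from rfl, Real.rpow_sub ht, Real.rpow_natCast]

/-- `s^{2α-j} = s^{2α}/s^j`. [folklore] -/
theorem rpow_two_mul_sub_nat {s : ℝ} (hs : 0 < s) (α : ℝ) (j : ℕ) :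
    s ^ (2 * α - j) = s ^ (2 * α) / s ^ j := by
  rw [Real.rpow_sub hs, Real.rpow_natCast]

variable {α a : ℝ} {t s : ℝ}

/-- `k = (1-t) A₀`, `A₀ = t^{-α}`. [folklore] -/
theorem kA_val (ht : 0 < t) : kA α t = (1 - t) * t ^ (-α) := kA_eq α ht

/-- `k' = -A₀ (α(1-t) + t)/t`. [folklore] -/
theorem deriv_kA_val (ht : 0 < t) : deriv (kA α) t = -(t ^ (-α)) * (α * (1 - t) + t) / t := by
  rw [deriv_kA α ht, show -α - 1 = -α - ((1 : ℕ) : ℝ) by norm_num, rpow_neg_sub_nat ht]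
  field_simp
  ring

/-- `k'' = A₀ α ((α+1)(1-t) + 2t)/t²`. [folklore] -/
theorem deriv2_kA_val (ht : 0 < t) :
    deriv^[2] (kA α) t = t ^ (-α) * α * ((α + 1) * (1 - t) + 2 * t) / t ^ 2 := by
  rw [deriv2_kA α ht, show -α - 2 = -α - ((2 : ℕ) : ℝ) by norm_num,
    show -α - 1 = -α - ((1 : ℕ) : ℝ) by norm_num, rpow_neg_sub_nat ht, rpow_neg_sub_nat ht]
  field_simp
  ring

/-- `ρ = B₀`, `ρ' = 2α B₀/s`, `ρ'' = 2α(2α-1) B₀/s²`, `ρ⁗ = 2α(2α-1)(2α-2)(2α-3) B₀/s⁴`. [folklore] -/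
theorem rhoA_vals (hs : 0 < s) :
    rhoA α s = s ^ (2 * α) ∧ deriv (rhoA α) s = 2 * α * s ^ (2 * α) / s ∧
      deriv^[2] (rhoA α) s = 2 * α * (2 * α - 1) * s ^ (2 * α) / s ^ 2 ∧
      deriv^[4] (rhoA α) s = 2 * α * (2 * α - 1) * (2 * α - 2) * (2 * α - 3) * s ^ (2 * α) / s ^ 4 := by
  refine ⟨rfl, ?_, ?_, ?_⟩
  · rw [deriv_rhoA]
    dsimp only
    rw [show 2 * α - 1 = 2 * α - ((1 : ℕ) : ℝ) by norm_num, rpow_two_mul_sub_nat hs, pow_one]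
    ring
  · rw [deriv2_rhoA]
    dsimp only
    rw [show 2 * α - 2 = 2 * α - ((2 : ℕ) : ℝ) by norm_num, rpow_two_mul_sub_nat hs]
    ring
  · rw [deriv4_rhoA]
    dsimp only
    rw [show (2 * α - 4 : ℝ) = 2 * α - ((4 : ℕ) : ℝ) by norm_num, rpow_two_mul_sub_nat hs]
    ring

end SecondProfiles


section SecondPointwise

variable {E : Type*} [NormedAddCommGroup E] [InnerProductSpace ℝ E]

/-- **The scalar inequality behind (A.1.19)–(A.1.23)**: with `A = t^{-α} ≥ 1`, `B = xₙ^{2α} ≥ 1`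
abstracted to real parameters, `0 < t ≤ 1`, `σ = xₙ ≥ 1`, `a ≥ 2`, `1/2 < α < 1`, the weight
`W` (with `k = (1-t)A`, `k' = -A(α(1-t)+t)/t`, `k'' = Aα((α+1)(1-t)+2t)/t²`, `ρ = B`,
`ρ' = 2αB/σ`, `ρ'' = 2α(2α-1)B/σ²`, `ρ⁗ = 2α(2α-1)(2α-2)(2α-3)B/σ⁴`) dominates
`t (a k ρ')² + a(2α-1) B A`. The proof is Seregin's: `W - rhs = T₀ + T₁ + T₂ + T₃` with
`T₀ = 4t² φ⁽²⁾ᵢⱼφ⁽²⁾ᵢφ⁽²⁾ⱼ ≥ 0`, `T₂ = t²A₁ - t g² ≥ 0` ((A.1.22)), `T₁ = t²A₂ ≥ 0` (needs `a ≥ 2`),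
`T₃ = t²A₃ - a(2α-1)BA = aBA(1-α)²(1-t) ≥ 0` ((A.1.21)). [cite: Seregin2014, App. A.1 (A.1.19)–(A.1.23)] -/
theorem weightW_core {α a t σ A B : ℝ} (hα : 1 / 2 < α) (hα1 : α < 1) (ha : 2 ≤ a)
    (ht0 : 0 < t) (ht1 : t ≤ 1) (hs1 : 1 ≤ σ) (hA1 : 1 ≤ A) (hB1 : 1 ≤ B) :
    t * (a * ((1 - t) * A) * (2 * α * B / σ)) ^ 2 + a * (2 * α - 1) * B * A ≤
      4 * t ^ 2 * (a * ((1 - t) * A) * (2 * α * (2 * α - 1) * B / σ ^ 2)) *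
          (a * ((1 - t) * A) * (2 * α * B / σ)) ^ 2 +
        t ^ 2 * (a * (A * α * ((α + 1) * (1 - t) + 2 * t) / t ^ 2) * B) -
        4 * t ^ 2 * (a * ((1 - t) * A) * (2 * α * B / σ)) *
          (a * (-A * (α * (1 - t) + t) / t) * (2 * α * B / σ)) -
        t ^ 2 * (a * ((1 - t) * A) * (2 * α * (2 * α - 1) * (2 * α - 2) * (2 * α - 3) * B / σ ^ 4)) -
        t * (a * ((1 - t) * A) * (2 * α * B / σ)) ^ 2 +
        t * (a * (-A * (α * (1 - t) + t) / t) * B) := by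
  have hA0 : 0 < A := by linarith
  have hB0 : 0 < B := by linarith
  have hσ0 : 0 < σ := by linarith
  have htne : t ≠ 0 := ht0.ne'
  have hσne : σ ≠ 0 := hσ0.ne'
  have h1t : 0 ≤ 1 - t := by linarith
  have h2α1 : 0 ≤ 2 * α - 1 := by linarith
  have ha0 : 0 ≤ a := by linarith
  have hbr : 0 ≤ (2 * α - 1) * (1 - t) + 2 * t := add_nonneg (mul_nonneg h2α1 h1t) (by linarith)
  -- the four nonnegative pieces
  have h0 : 0 ≤ 4 * t ^ 2 * (a * ((1 - t) * A) * (2 * α * (2 * α - 1) * B / σ ^ 2)) *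
      (a * ((1 - t) * A) * (2 * α * B / σ)) ^ 2 := by
    have : 0 ≤ a * ((1 - t) * A) * (2 * α * (2 * α - 1) * B / σ ^ 2) := by
      apply mul_nonneg (mul_nonneg ha0 (mul_nonneg h1t hA0.le))
      apply div_nonneg _ (sq_nonneg _)
      exact mul_nonneg (mul_nonneg (by linarith) h2α1) hB0.le
    exact mul_nonneg (mul_nonneg (by positivity) this) (sq_nonneg _)
  have h2 : 0 ≤ t * a ^ 2 * (2 * α * B / σ) ^ 2 * ((1 - t) * A) * (A * ((2 * α - 1) * (1 - t) + 2 * t)) :=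
    mul_nonneg (mul_nonneg (mul_nonneg (mul_nonneg ht0.le (sq_nonneg _)) (sq_nonneg _))
      (mul_nonneg h1t hA0.le)) (mul_nonneg hA0.le hbr)
  have h3 : 0 ≤ a * B * A * (1 - α) ^ 2 * (1 - t) :=
    mul_nonneg (mul_nonneg (mul_nonneg (mul_nonneg ha0 hB0.le) hA0.le) (sq_nonneg _)) h1t
  -- `T₁ = t a (1-t) A · 2α · [bracket]`, bracket ≥ 0 for `a ≥ 2`
  have hbracket : 0 ≤ 2 * α * a * B ^ 2 * A * ((2 * α - 1) * (1 - t) + 2 * t) / σ ^ 2 -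
      t * ((2 * α - 1) * (2 * α - 2) * (2 * α - 3)) * B / σ ^ 4 := by
    rw [sub_nonneg, div_le_div_iff₀ (by positivity) (by positivity)]
    have hσ2 : σ ^ 2 ≤ σ ^ 4 := by
      have h1 : 1 ≤ σ ^ 2 := by nlinarith
      nlinarith [sq_nonneg (σ ^ 2)]
    have hp : (2 * α - 2) * (2 * α - 3) ≤ 2 := by nlinarith
    have hp0 : 0 ≤ (2 * α - 2) * (2 * α - 3) := by nlinarith
    have hq : (2 * α - 1) ≤ (2 * α - 1) * (1 - t) + 2 * t := by nlinarith
    have hB2A : B ≤ B ^ 2 * A := by nlinarith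
    have lhs_le : t * ((2 * α - 1) * (2 * α - 2) * (2 * α - 3)) * B * σ ^ 2 ≤
        2 * (2 * α - 1) * B * σ ^ 4 := by
      have hx : t * ((2 * α - 1) * (2 * α - 2) * (2 * α - 3)) ≤ 1 * ((2 * α - 1) * 2) := by
        calc t * ((2 * α - 1) * (2 * α - 2) * (2 * α - 3))
            = t * ((2 * α - 1) * ((2 * α - 2) * (2 * α - 3))) := by ring
          _ ≤ 1 * ((2 * α - 1) * 2) := by
              apply mul_le_mul ht1 _ (mul_nonneg h2α1 hp0) zero_le_one
              exact mul_le_mul_of_nonneg_left hp h2α1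
      calc t * ((2 * α - 1) * (2 * α - 2) * (2 * α - 3)) * B * σ ^ 2
          ≤ 1 * ((2 * α - 1) * 2) * B * σ ^ 2 :=
            mul_le_mul_of_nonneg_right (mul_le_mul_of_nonneg_right hx hB0.le) (sq_nonneg _)
        _ ≤ 1 * ((2 * α - 1) * 2) * B * σ ^ 4 := by
            apply mul_le_mul_of_nonneg_left hσ2
            exact mul_nonneg (mul_nonneg zero_le_one (mul_nonneg h2α1 (by norm_num))) hB0.le
        _ = 2 * (2 * α - 1) * B * σ ^ 4 := by ring
    have rhs_ge : 2 * (2 * α - 1) * B * σ ^ 4 ≤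
        2 * α * a * B ^ 2 * A * ((2 * α - 1) * (1 - t) + 2 * t) * σ ^ 4 := by
      apply mul_le_mul_of_nonneg_right _ (by positivity)
      have hαa : 2 ≤ 2 * α * a := by nlinarith
      have hαa0 : 0 ≤ 2 * α * a := by linarith
      calc 2 * (2 * α - 1) * B = 2 * ((2 * α - 1) * B) := by ring
        _ ≤ (2 * α * a) * ((2 * α - 1) * B) :=
            mul_le_mul_of_nonneg_right hαa (mul_nonneg h2α1 hB0.le)
        _ ≤ (2 * α * a) * (((2 * α - 1) * (1 - t) + 2 * t) * (B ^ 2 * A)) := by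
            apply mul_le_mul_of_nonneg_left _ hαa0
            exact mul_le_mul hq hB2A hB0.le hbr
        _ = 2 * α * a * B ^ 2 * A * ((2 * α - 1) * (1 - t) + 2 * t) := by ring
    exact lhs_le.trans rhs_ge
  have h1 : 0 ≤ t * a * ((1 - t) * A) * (2 * α) *
      (2 * α * a * B ^ 2 * A * ((2 * α - 1) * (1 - t) + 2 * t) / σ ^ 2 -
        t * ((2 * α - 1) * (2 * α - 2) * (2 * α - 3)) * B / σ ^ 4) :=
    mul_nonneg (mul_nonneg (mul_nonneg (mul_nonneg ht0.le ha0) (mul_nonneg h1t hA0.le))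
      (by linarith)) hbracket
  -- the identity `W - rhs = T₀ + T₁ + T₂ + T₃`
  have hid : (4 * t ^ 2 * (a * ((1 - t) * A) * (2 * α * (2 * α - 1) * B / σ ^ 2)) *
          (a * ((1 - t) * A) * (2 * α * B / σ)) ^ 2 +
        t ^ 2 * (a * (A * α * ((α + 1) * (1 - t) + 2 * t) / t ^ 2) * B) -
        4 * t ^ 2 * (a * ((1 - t) * A) * (2 * α * B / σ)) *
          (a * (-A * (α * (1 - t) + t) / t) * (2 * α * B / σ)) -
        t ^ 2 * (a * ((1 - t) * A) * (2 * α * (2 * α - 1) * (2 * α - 2) * (2 * α - 3) * B / σ ^ 4)) -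
        t * (a * ((1 - t) * A) * (2 * α * B / σ)) ^ 2 +
        t * (a * (-A * (α * (1 - t) + t) / t) * B)) -
      (t * (a * ((1 - t) * A) * (2 * α * B / σ)) ^ 2 + a * (2 * α - 1) * B * A) =
      (4 * t ^ 2 * (a * ((1 - t) * A) * (2 * α * (2 * α - 1) * B / σ ^ 2)) *
          (a * ((1 - t) * A) * (2 * α * B / σ)) ^ 2) +
      (t * a * ((1 - t) * A) * (2 * α) *
        (2 * α * a * B ^ 2 * A * ((2 * α - 1) * (1 - t) + 2 * t) / σ ^ 2 -
          t * ((2 * α - 1) * (2 * α - 2) * (2 * α - 3)) * B / σ ^ 4)) +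
      (t * a ^ 2 * (2 * α * B / σ) ^ 2 * ((1 - t) * A) * (A * ((2 * α - 1) * (1 - t) + 2 * t))) +
      (a * B * A * (1 - α) ^ 2 * (1 - t)) := by
    field_simp
    ring
  have hsum := add_nonneg (add_nonneg (add_nonneg h0 h1) h2) h3
  rw [← hid] at hsum
  linarith

/-- **The lower bound for the zeroth-order weight of the anisotropic Carleman weight**
(Seregin 2014, (A.1.19)–(A.1.23)): for `0 < t ≤ 1`, `xₙ ≥ 1`, `a ≥ 2`, `1/2 < α < 1`,
`t (a k ρ')² + a(2α-1) xₙ^{2α} t^{-α} ≤ W`. [cite: Seregin2014, App. A.1 (A.1.19)–(A.1.23)] -/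
theorem weightW_lower_bound {α a : ℝ} (hα : 1 / 2 < α) (hα1 : α < 1) (ha : 2 ≤ a) (en : E)
    {z : ℝ × E} (ht0 : 0 < z.1) (ht1 : z.1 ≤ 1) (hs1 : 1 ≤ ⟪z.2, en⟫) :
    z.1 * (a * kA α z.1 * deriv (rhoA α) ⟪z.2, en⟫) ^ 2 +
        a * (2 * α - 1) * ⟪z.2, en⟫ ^ (2 * α) * z.1 ^ (-α) ≤
      weightW a (kA α) (rhoA α) en z := by
  have hσ0 : 0 < ⟪z.2, en⟫ := by linarith
  obtain ⟨hρ0, hρ1, hρ2, hρ4⟩ := rhoA_vals (α := α) hσ0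
  have hA1 : 1 ≤ z.1 ^ (-α) := Real.one_le_rpow_of_pos_of_le_one_of_nonpos ht0 ht1 (by linarith)
  have hB1 : 1 ≤ ⟪z.2, en⟫ ^ (2 * α) := Real.one_le_rpow hs1 (by linarith)
  have h := weightW_core hα hα1 ha ht0 ht1 hs1 hA1 hB1
  simp only [weightW]
  rw [kA_val ht0, deriv_kA_val ht0, deriv2_kA_val ht0, hρ0, hρ1, hρ2, hρ4]
  exact h

end SecondPointwise


section SecondInequality

variable {E : Type*} [NormedAddCommGroup E] [InnerProductSpace ℝ E] [FiniteDimensional ℝ E]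
  [MeasurableSpace E] [BorelSpace E]
variable {F : Type*} [NormedAddCommGroup F] [InnerProductSpace ℝ F]

/-- The anisotropic Carleman weight of Prop. 1.3:
`φ(x, t) = -|x'|²/(8t) + a(1 - t) xₙ^{2α}/t^α` (an abbreviation of `phiKR a k_α ρ_α eₙ`). [cite: Seregin2014, App. A.1 Prop. 1.3] -/
abbrev phiA (a α : ℝ) (en : E) : ℝ × E → ℝ := phiKR a (kA α) (rhoA α) en

omit [FiniteDimensional ℝ E] [MeasurableSpace E] [BorelSpace E] in
/-- `e^{2x} = (e^x)²`. [folklore] -/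
theorem exp_two_mul_eq_sq (x : ℝ) : Real.exp (2 * x) = Real.exp x ^ 2 := by
  rw [sq, ← Real.exp_add]; ring_nf

/-- **The second (anisotropic) Carleman inequality of Escauriaza–Seregin–Šverák**
(Seregin 2014, App. A.1, Prop. 1.3, (A.1.12); ESS 2003, §6): let `1/2 < α < 1`, `a ≥ 2`, `eₙ` a
unit vector of the finite-dimensional real inner product space `E` (`xₙ = ⟪x, eₙ⟫`,
`x' = x - xₙeₙ`), and
`φ(x, t) = -|x'|²/(8t) + a(1 - t) xₙ^{2α}/t^α`.
Then for every `u ∈ C_c^∞` with compact support in the open set `(ℝⁿ₊ + eₙ) × ]0, 1[`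
(`= {xₙ > 1} × ]0,1[`),
`∫ t² e^{2φ} (a |u|²/t² + |∇u|²/t) dx dt ≤ c⋆ ∫ t² e^{2φ} |∂ₜu + Δu|² dx dt`,
with the explicit constant `c⋆(α) = 5 + 3/(2α - 1)` and threshold `a₀(α) = 2` (the source:
`c⋆ = c⋆(α)`, `a > a₀(α)` unspecified). The integrals are over all of `ℝ × E`; the integrands
vanish off the support of `u`. Proof: Seregin's — `v = e^φ u`, `tLv = Sv + Av`
(`CarlemanConjugate`), `∫ t²|Lv|² ≥ I = 2∫⟪Sv,Av⟫` ((A.1.5)), the exact evaluation of `I` for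
this weight (`two_mul_integral_inner_opSW_opAW_phiKR`, (A.1.17)–(A.1.18)), the lower bound
(A.1.19)–(A.1.23) (`weightW_lower_bound`), then (A.1.24)–(A.1.26) and the elementary
`-2⟪v, tLv⟫ ≤ |v|² + t²|Lv|²`. [cite: Seregin2014, App. A.1 Prop. 1.3 (A.1.12)] -/
theorem carleman_inequality_second {α a : ℝ} (hα : 1 / 2 < α) (hα1 : α < 1) (ha : 2 ≤ a)
    {en : E} (hen : ‖en‖ = 1) {U : ℝ × E → F} (hU : ContDiff ℝ (⊤ : ℕ∞) U)
    (hUc : HasCompactSupport U) (hUs : tsupport U ⊆ Ioo (0 : ℝ) 1 ×ˢ {x : E | 1 < ⟪x, en⟫}) :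
    ∫ z, z.1 ^ 2 * Real.exp (2 * phiKR a (kA α) (rhoA α) en z) *
        (a * ‖U z‖ ^ 2 / z.1 ^ 2 + gradSq U z / z.1) ≤
      (5 + 3 / (2 * α - 1)) *
        ∫ z, z.1 ^ 2 * Real.exp (2 * phiKR a (kA α) (rhoA α) en z) * ‖dt U z + lap U z‖ ^ 2 := by
  set φ : ℝ × E → ℝ := phiKR a (kA α) (rhoA α) en with hφdef
  have h2α : 0 < 2 * α - 1 := by linarith
  -- ## degenerate case: `u = 0`
  by_cases hne : (tsupport U).Nonempty
  swap
  · have hU0 : ∀ z, U z = 0 := fun z =>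
      image_eq_zero_of_notMem_tsupport fun h => hne ⟨z, h⟩
    have hdU0 : ∀ z, fderiv ℝ U z = 0 := fun z =>
      fderiv_of_notMem_tsupport (𝕜 := ℝ) fun h => hne ⟨z, h⟩
    have hlap0 : ∀ z, lap U z = 0 := fun z =>
      image_eq_zero_of_notMem_tsupport fun h => hne ⟨z, tsupport_lap_subset U h⟩
    have hg0 : ∀ z, gradSq U z = 0 := fun z => by simp [gradSq, dx, hdU0 z]
    simp [hU0, hg0, hlap0, dt, hdU0]
  -- ## geometry of the support
  set Ω : Set (ℝ × E) := halfDom en with hΩdef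
  have hΩ : IsOpen Ω := isOpen_halfDom en
  have hk := contDiffOn_kA α
  have hρ := contDiffOn_rhoA α
  have hφ : ContDiffOn ℝ (⊤ : ℕ∞) φ Ω := contDiffOn_phiKR hk hρ a en
  obtain ⟨z₀, hz₀, hmin⟩ := hUc.isCompact.exists_isMinOn hne continuous_fst.continuousOn
  set δ : ℝ := z₀.1 with hδdef
  have hδ : 0 < δ := (hUs hz₀).1.1
  have hUδ : tsupport U ⊆ {z | δ ≤ z.1} := fun z hz => hmin hz
  have hUin : ∀ z ∈ tsupport U, 0 < z.1 ∧ z.1 < 1 ∧ 1 < ⟪z.2, en⟫ := fun z hz =>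
    ⟨(hUs hz).1.1, (hUs hz).1.2, (hUs hz).2⟩
  have hUΩ : tsupport U ⊆ Ω := fun z hz => ⟨(hUin z hz).1, by linarith only [(hUin z hz).2.2]⟩
  -- ## the conjugated field
  set V : ℝ × E → F := expConj φ U with hVdef
  have hV : ContDiff ℝ (⊤ : ℕ∞) V := contDiff_expConj hΩ hφ hU hUΩ
  have hVs : tsupport V ⊆ tsupport U := tsupport_expConj_subset
  have hVc : HasCompactSupport V := hasCompactSupport_expConj hUc
  have hVΩ : tsupport V ⊆ Ω := hVs.trans hUΩ
  have hVδ : tsupport V ⊆ {z | δ ≤ z.1} := hVs.trans hUδ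
  have hVin : ∀ z ∈ tsupport V, 0 < z.1 ∧ z.1 < 1 ∧ 1 < ⟪z.2, en⟫ := fun z hz => hUin z (hVs hz)
  have hV00 : ∀ z ∉ tsupport V, V z = 0 := fun z hz => image_eq_zero_of_notMem_tsupport hz
  have hnV : ∀ z, ‖V z‖ ^ 2 = Real.exp (φ z) ^ 2 * ‖U z‖ ^ 2 := fun z => by
    rw [hVdef, expConj_apply, norm_smul, Real.norm_eq_abs, abs_of_pos (Real.exp_pos _)]; ring
  -- ## continuity / integrability toolkit
  have cV : Continuous V := hV.continuous
  have cS : Continuous (opSW φ V) := continuous_opSW hΩ hφ hV hVΩ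
  have cA : Continuous (opAW φ V) := continuous_opAW hΩ hφ hV hVΩ
  have cSA : Continuous fun z => opSW φ V z + opAW φ V z := cS.add cA
  have hSAs : tsupport (fun z => opSW φ V z + opAW φ V z) ⊆ tsupport V := by
    refine closure_minimal (fun z hz => ?_) (isClosed_tsupport V)
    by_contra h
    have h1 : opSW φ V z = 0 := image_eq_zero_of_notMem_tsupport fun h' => h (tsupport_opSW_subset h')
    have h2 : opAW φ V z = 0 := image_eq_zero_of_notMem_tsupport fun h' => h (tsupport_opAW_subset h')
    exact hz (by simp [h1, h2])
  have hSAc : HasCompactSupport fun z => opSW φ V z + opAW φ V z :=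
    hVc.mono' ((subset_tsupport _).trans hSAs)
  have hV2c : HasCompactSupport (fun z => ‖V z‖ ^ 2) := hVc.comp_left (g := fun y : F => ‖y‖ ^ 2) (by simp)
  have hSA2c : HasCompactSupport (fun z => ‖opSW φ V z + opAW φ V z‖ ^ 2) :=
    hSAc.comp_left (g := fun y : F => ‖y‖ ^ 2) (by simp)
  have iV2 : Integrable fun z => ‖V z‖ ^ 2 := (cV.norm.pow 2).integrable_of_hasCompactSupport hV2c
  have iJ : Integrable fun z => ‖opSW φ V z + opAW φ V z‖ ^ 2 :=
    (cSA.norm.pow 2).integrable_of_hasCompactSupport hSA2c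
  have iSA : Integrable fun z => ⟪V z, opSW φ V z + opAW φ V z⟫ :=
    (continuous_inner.comp (cV.prodMk cSA)).integrable_of_hasCompactSupport
      (hVc.mono fun z hz => by
        contrapose! hz
        simp [notMem_support.1 hz])
  set J : ℝ := ∫ z, ‖opSW φ V z + opAW φ V z‖ ^ 2 with hJdef
  -- ## `J = ∫ t² e^{2φ} |∂ₜu + Δu|²` ((A.1.2))
  have hJ : J = ∫ z, z.1 ^ 2 * Real.exp (2 * φ z) * ‖dt U z + lap U z‖ ^ 2 := by
    refine integral_congr_ae (Eventually.of_forall fun z => ?_)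
    show ‖opSW φ V z + opAW φ V z‖ ^ 2 = z.1 ^ 2 * Real.exp (2 * φ z) * ‖dt U z + lap U z‖ ^ 2
    rw [hVdef, opSW_add_opAW_expConj hΩ hφ hU hUΩ z, norm_smul, mul_pow, Real.norm_eq_abs, sq_abs,
      exp_two_mul_eq_sq]
    ring
  have hJ0 : 0 ≤ J := integral_nonneg fun z => sq_nonneg _
  -- ## `I ≤ J` ((A.1.5)) and the evaluation of `I`
  have hIJ : 2 * ∫ z, ⟪opSW φ V z, opAW φ V z⟫ ≤ J :=
    two_mul_integral_inner_opSW_opAW_le hΩ hφ hV hVc hVΩ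
  have hI := two_mul_integral_inner_opSW_opAW_phiKR hk hρ hen hδ hV hVc hVΩ hVδ (a := a)
  -- the two gradient terms are nonnegative
  have hkv : ∀ z ∈ tsupport V, 0 ≤ kA α z.1 := fun z hz => by
    rw [kA_eq α (hVin z hz).1]
    exact mul_nonneg (by linarith only [(hVin z hz).2.1]) (Real.rpow_nonneg (hVin z hz).1.le _)
  have hρ2v : ∀ z ∈ tsupport V, 0 ≤ deriv^[2] (rhoA α) ⟪z.2, en⟫ := fun z hz => by
    rw [deriv2_rhoA]
    have hs : 0 < ⟪z.2, en⟫ := by linarith only [(hVin z hz).2.2]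
    exact mul_nonneg (mul_nonneg (by linarith only [hα]) h2α.le) (Real.rpow_nonneg hs.le _)
  have hdV0 : ∀ z ∉ tsupport V, fderiv ℝ V z = 0 := fun z hz => fderiv_of_notMem_tsupport (𝕜 := ℝ) hz
  have hN1 : 0 ≤ ∫ z, z.1 * ‖fderiv ℝ V z (0, en)‖ ^ 2 := by
    refine integral_nonneg fun z => ?_
    by_cases hz : z ∈ tsupport V
    · exact mul_nonneg (hVin z hz).1.le (sq_nonneg _)
    · simp [hdV0 z hz]
  have hN2 : 0 ≤ ∫ z, z.1 ^ 2 * (a * kA α z.1 * deriv^[2] (rhoA α) ⟪z.2, en⟫) *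
      ‖fderiv ℝ V z (0, en)‖ ^ 2 := by
    refine integral_nonneg fun z => ?_
    by_cases hz : z ∈ tsupport V
    · exact mul_nonneg (mul_nonneg (sq_nonneg _)
        (mul_nonneg (mul_nonneg (by linarith only [ha]) (hkv z hz)) (hρ2v z hz))) (sq_nonneg _)
    · simp [hdV0 z hz]
  have hWJ : ∫ z, weightW a (kA α) (rhoA α) en z * ‖V z‖ ^ 2 ≤ J := by linarith only [hI, hIJ, hN1, hN2]
  -- ## the lower bound for `∫ W |v|²` ((A.1.19)–(A.1.23))
  set g : ℝ × E → ℝ := fun z => a * kA α z.1 * deriv (rhoA α) ⟪z.2, en⟫ with hgdef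
  set BA : ℝ × E → ℝ := fun z => ⟪z.2, en⟫ ^ (2 * α) * z.1 ^ (-α) with hBAdef
  have ck : ∀ j, ContinuousOn (fun z : ℝ × E => deriv^[j] (kA α) z.1) Ω := fun j =>
    (contDiffOn_iterate_deriv_Ioi hk j).continuousOn.comp continuous_fst.continuousOn fun z hz => hz.1
  have cρ : ∀ j, ContinuousOn (fun z : ℝ × E => deriv^[j] (rhoA α) ⟪z.2, en⟫) Ω := fun j =>
    (contDiffOn_iterate_deriv_Ioi hρ j).continuousOn.comp
      (continuous_snd.inner continuous_const).continuousOn fun z hz => hz.2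
  have ct : ContinuousOn (fun z : ℝ × E => z.1) Ω := continuous_fst.continuousOn
  have cg : ContinuousOn g Ω := (continuousOn_const.mul (ck 0)).mul (cρ 1)
  have cBA : ContinuousOn BA Ω :=
    ((continuous_snd.inner continuous_const).continuousOn.rpow_const fun z hz => Or.inl hz.2.ne').mul
      (ct.rpow_const fun z hz => Or.inl hz.1.ne')
  have iW := integrable_mul_norm_sq_of_open hΩ hV hVc hVΩ (continuousOn_weightW hk hρ (a := a) (en := en))
  have iL1 := integrable_mul_norm_sq_of_open hΩ hV hVc hVΩ (w := fun z => z.1 * g z ^ 2) (ct.mul (cg.pow 2))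
  have iL2 := integrable_mul_norm_sq_of_open hΩ hV hVc hVΩ (w := BA) cBA
  set L1 : ℝ := ∫ z, z.1 * g z ^ 2 * ‖V z‖ ^ 2 with hL1
  set L2 : ℝ := ∫ z, BA z * ‖V z‖ ^ 2 with hL2
  have hBA1 : ∀ z ∈ tsupport V, 1 ≤ BA z := fun z hz => by
    have h1 : 1 ≤ ⟪z.2, en⟫ ^ (2 * α) := Real.one_le_rpow (hVin z hz).2.2.le (by linarith)
    have h2 : 1 ≤ z.1 ^ (-α) :=
      Real.one_le_rpow_of_pos_of_le_one_of_nonpos (hVin z hz).1 (hVin z hz).2.1.le (by linarith)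
    simp only [hBAdef]
    nlinarith only [h1, h2]
  have hL10 : 0 ≤ L1 := integral_nonneg fun z => by
    by_cases hz : z ∈ tsupport V
    · exact mul_nonneg (mul_nonneg (hVin z hz).1.le (sq_nonneg _)) (sq_nonneg _)
    · simp [hV00 z hz]
  have hL20 : 0 ≤ L2 := integral_nonneg fun z => by
    by_cases hz : z ∈ tsupport V
    · exact mul_nonneg (by linarith only [hBA1 z hz]) (sq_nonneg _)
    · simp [hV00 z hz]
  have hlow : L1 + a * (2 * α - 1) * L2 ≤ ∫ z, weightW a (kA α) (rhoA α) en z * ‖V z‖ ^ 2 := by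
    rw [hL1, hL2, ← integral_const_mul, ← integral_add iL1 (iL2.const_mul _)]
    refine integral_mono (iL1.add (iL2.const_mul _)) iW fun z => ?_
    by_cases hz : z ∈ tsupport V
    · have h := weightW_lower_bound hα hα1 ha en (hVin z hz).1 (hVin z hz).2.1.le (hVin z hz).2.2.le
      show z.1 * g z ^ 2 * ‖V z‖ ^ 2 + a * (2 * α - 1) * (BA z * ‖V z‖ ^ 2) ≤
        weightW a (kA α) (rhoA α) en z * ‖V z‖ ^ 2
      simp only [hgdef, hBAdef] at h ⊢
      nlinarith only [sq_nonneg ‖V z‖, h]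
    · show z.1 * g z ^ 2 * ‖V z‖ ^ 2 + a * (2 * α - 1) * (BA z * ‖V z‖ ^ 2) ≤
        weightW a (kA α) (rhoA α) en z * ‖V z‖ ^ 2
      simp [hV00 z hz]
  have hL2' : 0 ≤ a * (2 * α - 1) * L2 := mul_nonneg (mul_nonneg (by linarith only [ha]) h2α.le) hL20
  have hL1J : L1 ≤ J := by linarith only [hlow, hWJ, hL2']
  have hL2J : a * (2 * α - 1) * L2 ≤ J := by linarith only [hlow, hWJ, hL10]
  -- ## (A.1.24) and the integrated (A.1.11)
  have hG := integral_fst_mul_gradSq_eq hΩ hφ hV hVc hVΩ hδ hVδ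
  have cN : ContinuousOn (fun z => ‖gradX φ z‖ ^ 2) Ω := ((contDiffOn_gradX hΩ hφ).continuousOn.norm).pow 2
  have cq : ContinuousOn (qW φ) Ω := (contDiffOn_qW hΩ hφ).continuousOn
  have iN := integrable_mul_norm_sq_of_open hΩ hV hVc hVΩ (w := fun z => z.1 * ‖gradX φ z‖ ^ 2) (ct.mul cN)
  have iq := integrable_mul_norm_sq_of_open hΩ hV hVc hVΩ (w := fun z => z.1 * qW φ z) (ct.mul cq)
  have iGV : Integrable fun z : ℝ × E => z.1 * gradSq V z := integrable_mul_gradSq hV hVc continuous_id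
  have hdU0 : ∀ z ∉ tsupport U, fderiv ℝ U z = 0 := fun z hz => fderiv_of_notMem_tsupport (𝕜 := ℝ) hz
  have hU00 : ∀ z ∉ tsupport U, U z = 0 := fun z hz => image_eq_zero_of_notMem_tsupport hz
  have hGU0 : ∀ z ∉ tsupport U, gradSq U z = 0 := fun z hz => by simp [gradSq, dx, hdU0 z hz]
  have hGV0 : ∀ z ∉ tsupport V, gradSq V z = 0 := fun z hz => by simp [gradSq, dx, hdV0 z hz]
  have cGUf : Continuous fun z => gradSq U z := by
    unfold gradSq
    exact continuous_finsetSum _ fun i _ => ((contDiff_dx hU _).continuous.norm.pow 2)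
  have cGU : Continuous fun z => z.1 * Real.exp (φ z) ^ 2 * gradSq U z := by
    refine continuous_of_continuousOn_of_eq_zero hΩ (isClosed_tsupport U) hUΩ ?_ fun z hz => by
      simp [hGU0 z hz]
    exact (ct.mul (hφ.continuousOn.rexp.pow 2)).mul cGUf.continuousOn
  have hGUc : HasCompactSupport fun z => z.1 * Real.exp (φ z) ^ 2 * gradSq U z := by
    refine hUc.mono' fun z hz => ?_
    by_contra h
    exact hz (by simp [hGU0 z h])
  have iGU : Integrable fun z => z.1 * Real.exp (φ z) ^ 2 * gradSq U z :=
    cGU.integrable_of_hasCompactSupport hGUc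
  have h11 : ∫ z, z.1 * Real.exp (φ z) ^ 2 * gradSq U z ≤
      2 * (∫ z : ℝ × E, z.1 * gradSq V z) + 2 * ∫ z : ℝ × E, z.1 * ‖gradX φ z‖ ^ 2 * ‖V z‖ ^ 2 := by
    rw [← integral_const_mul, ← integral_const_mul, ← integral_add (iGV.const_mul 2) (iN.const_mul 2)]
    refine integral_mono iGU ((iGV.const_mul 2).add (iN.const_mul 2)) fun z => ?_
    show z.1 * Real.exp (φ z) ^ 2 * gradSq U z ≤
      2 * (z.1 * gradSq V z) + 2 * (z.1 * ‖gradX φ z‖ ^ 2 * ‖V z‖ ^ 2)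
    by_cases hz : z ∈ tsupport U
    · have h := exp_sq_mul_gradSq_le_of_mem hΩ hφ hU (hUΩ hz)
      rw [← hVdef] at h
      have ht : 0 ≤ z.1 := (hUin z hz).1.le
      nlinarith only [h, ht]
    · have hzV : z ∉ tsupport V := fun h => hz (hVs h)
      simp [hGU0 z hz, hGV0 z hzV, hV00 z hzV]
  -- ## `t q + t |∇φ|² = 2 t g² - t a k' ρ` on `Ω`
  have hqn : ∀ z ∈ Ω, z.1 * qW φ z + z.1 * ‖gradX φ z‖ ^ 2 =
      2 * (z.1 * g z ^ 2) + -(z.1 * (a * deriv (kA α) z.1 * rhoA α ⟪z.2, en⟫)) := by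
    intro z hz
    rw [qW, norm_gradX_phiKR_sq hk hρ a hen hz, dt_phiKR hk hρ a en hz]
    simp only [hgdef]
    have ht := hz.1.ne'
    field_simp
    ring
  have iL3 := integrable_mul_norm_sq_of_open hΩ hV hVc hVΩ
    (w := fun z => -(z.1 * (a * deriv (kA α) z.1 * rhoA α ⟪z.2, en⟫)))
    (ct.mul ((continuousOn_const.mul (ck 1)).mul (cρ 0))).neg
  set L3 : ℝ := ∫ z, -(z.1 * (a * deriv (kA α) z.1 * rhoA α ⟪z.2, en⟫)) * ‖V z‖ ^ 2 with hL3
  have hsumq : (∫ z, z.1 * qW φ z * ‖V z‖ ^ 2) + (∫ z, z.1 * ‖gradX φ z‖ ^ 2 * ‖V z‖ ^ 2) =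
      2 * L1 + L3 := by
    rw [← integral_add iq iN, hL1, hL3, ← integral_const_mul, ← integral_add (iL1.const_mul 2) iL3]
    refine integral_congr_ae (Eventually.of_forall fun z => ?_)
    show z.1 * qW φ z * ‖V z‖ ^ 2 + z.1 * ‖gradX φ z‖ ^ 2 * ‖V z‖ ^ 2 =
      2 * (z.1 * g z ^ 2 * ‖V z‖ ^ 2) + -(z.1 * (a * deriv (kA α) z.1 * rhoA α ⟪z.2, en⟫)) * ‖V z‖ ^ 2
    by_cases hz : z ∈ Ω
    · have h := hqn z hz
      have : z.1 * qW φ z * ‖V z‖ ^ 2 + z.1 * ‖gradX φ z‖ ^ 2 * ‖V z‖ ^ 2 =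
          (z.1 * qW φ z + z.1 * ‖gradX φ z‖ ^ 2) * ‖V z‖ ^ 2 := by ring
      rw [this, h]
      ring
    · have hzV : z ∉ tsupport V := fun h => hz (hVΩ h)
      simp [hV00 z hzV]
  -- ## `L₃ ≤ a L₂`:  `-t k' ρ = A (α(1-t) + t) B ≤ A B` on the support
  have hL3 : L3 ≤ a * L2 := by
    rw [hL3, hL2, ← integral_const_mul]
    refine integral_mono iL3 (iL2.const_mul a) fun z => ?_
    show -(z.1 * (a * deriv (kA α) z.1 * rhoA α ⟪z.2, en⟫)) * ‖V z‖ ^ 2 ≤ a * (BA z * ‖V z‖ ^ 2)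
    by_cases hz : z ∈ tsupport V
    · obtain ⟨ht0, ht1, hs1⟩ := hVin z hz
      have hs0 : 0 < ⟪z.2, en⟫ := by linarith only [hs1]
      have hA0 : 0 ≤ z.1 ^ (-α) := Real.rpow_nonneg ht0.le _
      have hB0 : 0 ≤ ⟪z.2, en⟫ ^ (2 * α) := Real.rpow_nonneg hs0.le _
      have key : -(z.1 * (a * deriv (kA α) z.1 * rhoA α ⟪z.2, en⟫)) =
          a * (z.1 ^ (-α) * ⟪z.2, en⟫ ^ (2 * α)) * (α * (1 - z.1) + z.1) := by
        rw [deriv_kA_val ht0, rhoA]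
        field_simp
      have hle : α * (1 - z.1) + z.1 ≤ 1 := by nlinarith only [hα1, ht1]
      have hnn : 0 ≤ a * (z.1 ^ (-α) * ⟪z.2, en⟫ ^ (2 * α)) := mul_nonneg (by linarith only [ha]) (mul_nonneg hA0 hB0)
      rw [key]
      have : a * (z.1 ^ (-α) * ⟪z.2, en⟫ ^ (2 * α)) * (α * (1 - z.1) + z.1) ≤ a * BA z := by
        calc a * (z.1 ^ (-α) * ⟪z.2, en⟫ ^ (2 * α)) * (α * (1 - z.1) + z.1)
            ≤ a * (z.1 ^ (-α) * ⟪z.2, en⟫ ^ (2 * α)) * 1 := mul_le_mul_of_nonneg_left hle hnn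
          _ = a * BA z := by simp only [hBAdef, mul_one]; ring
      nlinarith only [sq_nonneg ‖V z‖, this]
    · simp [hV00 z hz]
  -- ## the cross term: `-∫⟪v, Sv + Av⟫ ≤ ½∫|v|² + ½ J`
  have hcross : -(∫ z, ⟪V z, opSW φ V z + opAW φ V z⟫) ≤ 1 / 2 * (∫ z, ‖V z‖ ^ 2) + 1 / 2 * J := by
    rw [hJdef, ← integral_const_mul, ← integral_const_mul, ← integral_neg,
      ← integral_add (iV2.const_mul _) (iJ.const_mul _)]
    refine integral_mono iSA.neg ((iV2.const_mul _).add (iJ.const_mul _)) fun z => ?_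
    show -⟪V z, opSW φ V z + opAW φ V z⟫ ≤ 1 / 2 * ‖V z‖ ^ 2 + 1 / 2 * ‖opSW φ V z + opAW φ V z‖ ^ 2
    nlinarith only [norm_add_sq_real (V z) (opSW φ V z + opAW φ V z),
      sq_nonneg ‖V z + (opSW φ V z + opAW φ V z)‖]
  -- ## (A.1.26): the gradient of `u`
  have hgradU : ∫ z, z.1 * Real.exp (φ z) ^ 2 * gradSq U z ≤ (5 + 2 / (2 * α - 1)) * J := by
    have h2L2 : 2 * a * L2 ≤ 2 * J / (2 * α - 1) := by
      rw [le_div_iff₀ h2α]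
      linarith only [hL2J]
    calc ∫ z, z.1 * Real.exp (φ z) ^ 2 * gradSq U z
        ≤ 2 * (∫ z : ℝ × E, z.1 * gradSq V z) + 2 * ∫ z : ℝ × E, z.1 * ‖gradX φ z‖ ^ 2 * ‖V z‖ ^ 2 := h11
      _ = -(∫ z, ‖V z‖ ^ 2) - 2 * (∫ z, ⟪V z, opSW φ V z + opAW φ V z⟫) +
            2 * ((∫ z, z.1 * qW φ z * ‖V z‖ ^ 2) + ∫ z : ℝ × E, z.1 * ‖gradX φ z‖ ^ 2 * ‖V z‖ ^ 2) := by
          rw [hG]; ring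
      _ = -(∫ z, ‖V z‖ ^ 2) - 2 * (∫ z, ⟪V z, opSW φ V z + opAW φ V z⟫) + 2 * (2 * L1 + L3) := by
          rw [hsumq]
      _ ≤ -(∫ z, ‖V z‖ ^ 2) + ((∫ z, ‖V z‖ ^ 2) + J) + 4 * L1 + 2 * a * L2 := by
          linarith only [hcross, hL3]
      _ ≤ J + 4 * J + 2 * J / (2 * α - 1) := by linarith only [hL1J, h2L2]
      _ = (5 + 2 / (2 * α - 1)) * J := by ring
  -- ## the `L²` term: `a ∫ e^{2φ}|u|² = a ∫ |v|² ≤ a L₂ ≤ J/(2α-1)`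
  have hV2L2 : ∫ z, ‖V z‖ ^ 2 ≤ L2 := by
    rw [hL2]
    refine integral_mono iV2 iL2 fun z => ?_
    show ‖V z‖ ^ 2 ≤ BA z * ‖V z‖ ^ 2
    by_cases hz : z ∈ tsupport V
    · nlinarith only [hBA1 z hz, sq_nonneg ‖V z‖]
    · simp [hV00 z hz]
  have hU2 : a * ∫ z, ‖V z‖ ^ 2 ≤ J / (2 * α - 1) := by
    rw [le_div_iff₀ h2α]
    have : a * (∫ z, ‖V z‖ ^ 2) * (2 * α - 1) ≤ a * L2 * (2 * α - 1) :=
      mul_le_mul_of_nonneg_right (mul_le_mul_of_nonneg_left hV2L2 (by linarith only [ha])) h2α.le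
    linarith only [this, hL2J]
  -- ## the left-hand side splits as `a ∫|v|² + ∫ t e^{2φ}|∇u|²`
  have hLHS : ∫ z, z.1 ^ 2 * Real.exp (2 * φ z) * (a * ‖U z‖ ^ 2 / z.1 ^ 2 + gradSq U z / z.1) =
      a * (∫ z, ‖V z‖ ^ 2) + ∫ z, z.1 * Real.exp (φ z) ^ 2 * gradSq U z := by
    rw [← integral_const_mul, ← integral_add (iV2.const_mul a) iGU]
    refine integral_congr_ae (Eventually.of_forall fun z => ?_)
    show z.1 ^ 2 * Real.exp (2 * φ z) * (a * ‖U z‖ ^ 2 / z.1 ^ 2 + gradSq U z / z.1) =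
      a * ‖V z‖ ^ 2 + z.1 * Real.exp (φ z) ^ 2 * gradSq U z
    by_cases hz : z ∈ tsupport U
    · have ht : z.1 ≠ 0 := (hUin z hz).1.ne'
      rw [hnV, exp_two_mul_eq_sq]
      field_simp
    · have hzV : z ∉ tsupport V := fun h => hz (hVs h)
      simp [hU00 z hz, hGU0 z hz, hV00 z hzV]
  -- ## conclusion
  rw [hLHS, ← hJ]
  calc a * (∫ z, ‖V z‖ ^ 2) + ∫ z, z.1 * Real.exp (φ z) ^ 2 * gradSq U z
      ≤ J / (2 * α - 1) + (5 + 2 / (2 * α - 1)) * J := add_le_add hU2 hgradU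
    _ = (5 + 3 / (2 * α - 1)) * J := by ring

end SecondInequality

end Carleman

end Literature.Analysis.FluidPDE
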